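import Literature.Topology.FourManifolds.ClosedBallTangent
import Literature.Geometry.Riemannian.RoundSphere
import Literature.Geometry.Riemannian.RiemannianDistance
import HarnessLib

/-!
# The Euclidean metric `|dx|²` on the closed unit ball `𝔻ⁿ⁺¹` (manifold with boundary)

Topic `Geometry/Riemannian`. The closed unit ball `𝔻ⁿ⁺¹ ⊆ ℝⁿ⁺¹` is the tree's compact smooth
manifold with boundary `𝕊ⁿ` (model `𝓡∂ (n + 1)`, `Topology/FourManifolds/ClosedBall*.lean`); the
inclusion `𝔻ⁿ⁺¹ ↪ ℝⁿ⁺¹` is `C^∞` (`contMDiff_coe_closedBall`) with everywhere invertible differential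
`closedBallCoeDeriv x : T_x𝔻ⁿ⁺¹ ≃L ℝⁿ⁺¹` (`mfderiv_coe_closedBall`). Here we equip `𝔻ⁿ⁺¹` with the
**Euclidean metric** `ḡ = |dx|²` — the pullback of the Euclidean metric of `ℝⁿ⁺¹`
(`euclideanMetric`, O'Neill 1983, Ch. 3, p. 55) along the inclusion (pullback of a metric along an
equidimensional immersion, O'Neill 1983, Ch. 3, p. 58 and pp. 90–91: `PseudoRiemannianMetric.comap`):

* `closedBallEuclideanMetric n` — `ḡ` as a `C^∞` `PseudoRiemannianMetric (𝓡∂ (n + 1)) ∞` on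
  `T𝔻ⁿ⁺¹`, with `ḡ_x(v, w) = ⟪D_x v, D_x w⟫`, `D_x = closedBallCoeDeriv x`
  (`closedBallEuclideanMetric_val`; at interior points `D_x = id` and `ḡ_x(v, w) = ⟪v, w⟫`,
  `closedBallEuclideanMetric_val_of_norm_lt_one`); it is Riemannian
  (`isRiemannian_closedBallEuclideanMetric`);
* `closedBallEuclideanRiemannianMetric n hk` — the same as a Mathlib
  `Bundle.ContMDiffRiemannianMetric (𝓡∂ (n + 1)) k` for any `k ≤ ∞`: this is the shape of the
  compactified metric `ḡ` (regularity `k = 2`) in the conformally-compact-filling package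
  `IsConformallyCompactFillingOfDim` (`ConformallyCompactFilling.lean`; Li–Qing–Shi 2017, Def. 2.1:
  "`ḡ = x²g⁺` can be extended to a `C^{k,α}` Riemannian metric on `X̄ⁿ`"), of which the closed ball
  with `|dx|²` is the model case `X̄ = 𝔻`, `g⁺ = g_ℍ` (Lee 2018, Thm. 3.7 (c));
* the chain rule `closedBallCoeDeriv (f p) (df_p v) = d(val ∘ f)_p v` for maps into the ball
  (`closedBallCoeDeriv_mfderiv_apply`) and hence
  `ḡ_{f p}(df_p v, df_p w) = ⟪d(val ∘ f)_p v, d(val ∘ f)_p w⟫`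
  (`closedBallEuclideanMetric_val_mfderiv`): pullbacks of `ḡ` along maps into `𝔻ⁿ⁺¹` are computed
  ambiently (used for `j^*ḡ`, `ι^*ḡ` and `dρ` in the filling package).

Everything is proved; the two definitions are real; no named facts.

## References

* B. O'Neill, *Semi-Riemannian geometry* (1983), Ch. 3, p. 55 and pp. 58, 90–91. [ONeill1983]
* J. M. Lee, *Introduction to Riemannian Manifolds*, 2nd ed. (2018), Ch. 2 (induced metrics),
  Thm. 3.7 (c). [Lee2018]
* G. Li, J. Qing, Y. Shi, Trans. Amer. Math. Soc. 369 (2017), Def. 2.1 (p. 6). [LiQingShi2017]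
-/

noncomputable section

open scoped Manifold ContDiff Topology RealInnerProductSpace
open Bundle Literature.Topology.FourManifolds

namespace Literature.Geometry.Riemannian

open Literature.Geometry.Lorentzian (PseudoRiemannianMetric)
open Literature.Geometry.Lorentzian.PseudoRiemannianMetric

/-- `ℝⁿ` as `EuclideanSpace ℝ (Fin n)` (file-local notation). -/
local notation "𝔼 " n:arg => EuclideanSpace ℝ (Fin n)

/-- The closed unit ball `𝔻ⁿ ⊆ ℝⁿ` (file-local notation). -/
local notation "𝔻 " n:arg => (Metric.closedBall (0 : EuclideanSpace ℝ (Fin n)) 1)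

attribute [local instance] fact_finrank_euclideanSpace_succ

variable {n : ℕ}

/-! ### The inclusion `𝔻ⁿ⁺¹ ↪ ℝⁿ⁺¹` is an equidimensional immersion -/

/-- The differential of the inclusion `𝔻ⁿ⁺¹ ↪ ℝⁿ⁺¹` is injective at every point (it is the linear
isomorphism `closedBallCoeDeriv x`). [folklore] -/
theorem injective_mfderiv_coe_closedBall (x : 𝔻 (n + 1)) :
    Function.Injective
      (mfderiv (𝓡∂ (n + 1)) 𝓘(ℝ, 𝔼 (n + 1)) (Subtype.val : (𝔻 (n + 1)) → 𝔼 (n + 1)) x) := by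
  rw [mfderiv_coe_closedBall]
  exact (closedBallCoeDeriv x).injective

/-- The inclusion `𝔻ⁿ⁺¹ ↪ ℝⁿ⁺¹` is `C^{∞ + 1} = C^∞` (the regularity asked of an immersion along
which a `C^∞` metric is pulled back). [folklore] -/
theorem contMDiff_coe_closedBall_add_one :
    ContMDiff (𝓡∂ (n + 1)) 𝓘(ℝ, 𝔼 (n + 1)) (∞ + 1) (Subtype.val : (𝔻 (n + 1)) → 𝔼 (n + 1)) :=
  contMDiff_coe_closedBall

/-! ### The Euclidean metric of the closed ball -/

/-- **The Euclidean metric `ḡ = |dx|²` of the closed unit ball `𝔻ⁿ⁺¹`** (a `C^∞` Riemannian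
metric on the manifold with boundary `𝔻ⁿ⁺¹`, model `𝓡∂ (n + 1)`): the pullback of the Euclidean
metric of `ℝⁿ⁺¹` along the inclusion, `ḡ_x(v, w) = ⟪dι_x v, dι_x w⟫` (O'Neill 1983, Ch. 3, p. 55
and pp. 90–91). [cite: ONeill1983, Ch. 3, p. 55 and pp. 90–91] -/
def closedBallEuclideanMetric (n : ℕ) :
    PseudoRiemannianMetric (𝓡∂ (n + 1)) ∞ (𝔼 (n + 1))
      (TangentSpace (𝓡∂ (n + 1)) : (𝔻 (n + 1)) → Type _) :=
  (euclideanMetric (𝔼 (n + 1))).comap contMDiff_pullbackBilin_holds Subtype.val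
    contMDiff_coe_closedBall_add_one injective_mfderiv_coe_closedBall rfl

/-- `ḡ_x(v, w) = ⟪D_x v, D_x w⟫` with `D_x = closedBallCoeDeriv x` the differential of the
inclusion. [cite: ONeill1983, Ch. 3, Def. 3.9 and p. 55] -/
theorem closedBallEuclideanMetric_val (x : 𝔻 (n + 1)) (v w : TangentSpace (𝓡∂ (n + 1)) x) :
    (closedBallEuclideanMetric n).val x v w = ⟪closedBallCoeDeriv x v, closedBallCoeDeriv x w⟫ := by
  change (euclideanMetric (𝔼 (n + 1))).val x.1
      (mfderiv (𝓡∂ (n + 1)) 𝓘(ℝ, 𝔼 (n + 1)) (Subtype.val : (𝔻 (n + 1)) → 𝔼 (n + 1)) x v)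
      (mfderiv (𝓡∂ (n + 1)) 𝓘(ℝ, 𝔼 (n + 1)) (Subtype.val : (𝔻 (n + 1)) → 𝔼 (n + 1)) x w) = _
  rw [mfderiv_coe_closedBall, euclideanMetric_apply]
  rfl

/-- At an interior point `‖x‖ < 1` the differential of the inclusion is the identity, so
`ḡ_x(v, w) = ⟪v, w⟫`. [folklore] -/
theorem closedBallEuclideanMetric_val_of_norm_lt_one {x : 𝔻 (n + 1)} (h : ‖(x : 𝔼 (n + 1))‖ < 1)
    (v w : TangentSpace (𝓡∂ (n + 1)) x) :
    (closedBallEuclideanMetric n).val x v w = @inner ℝ (𝔼 (n + 1)) _ v w := by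
  rw [closedBallEuclideanMetric_val]
  have hv : closedBallCoeDeriv x v = v := by
    rw [← ContinuousLinearEquiv.coe_coe, closedBallCoeDeriv_of_norm_lt_one h]; rfl
  have hw : closedBallCoeDeriv x w = w := by
    rw [← ContinuousLinearEquiv.coe_coe, closedBallCoeDeriv_of_norm_lt_one h]; rfl
  rw [hv, hw]

/-- **`ḡ = |dx|²` on `𝔻ⁿ⁺¹` is Riemannian** (positive definite: `ḡ_x(v, v) = ‖D_x v‖² > 0` for
`v ≠ 0`, `D_x` injective). [cite: ONeill1983, Ch. 3, p. 55] -/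
theorem isRiemannian_closedBallEuclideanMetric : (closedBallEuclideanMetric n).IsRiemannian := by
  intro x v hv
  rw [closedBallEuclideanMetric_val]
  exact real_inner_self_pos.2 fun h ↦ hv ((closedBallCoeDeriv x).map_eq_zero_iff.1 h)

/-- `ḡ_x(v, v) = ‖D_x v‖²`. [folklore] -/
theorem closedBallEuclideanMetric_val_self (x : 𝔻 (n + 1)) (v : TangentSpace (𝓡∂ (n + 1)) x) :
    (closedBallEuclideanMetric n).val x v v = ‖closedBallCoeDeriv x v‖ ^ 2 := by
  rw [closedBallEuclideanMetric_val, real_inner_self_eq_norm_sq]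

/-! ### As a Mathlib `ContMDiffRiemannianMetric` of regularity `k ≤ ∞` -/

/-- **The Euclidean metric of `𝔻ⁿ⁺¹` as a Mathlib `C^k` Riemannian metric on the tangent bundle**
(`k ≤ ∞`; the conformally-compact-filling package of Li–Qing–Shi 2017, Def. 2.1 asks for the
compactified metric `ḡ` in this form with `k = 2`). [cite: LiQingShi2017, Def. 2.1]
[cite: ONeill1983, Ch. 3, p. 55] -/
def closedBallEuclideanRiemannianMetric (n : ℕ) {k : ℕ∞ω} (hk : k ≤ ∞) :
    Bundle.ContMDiffRiemannianMetric (𝓡∂ (n + 1)) k (𝔼 (n + 1))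
      (TangentSpace (𝓡∂ (n + 1)) : (𝔻 (n + 1)) → Type _) :=
  ((closedBallEuclideanMetric n).ofLE hk).toContMDiffRiemannianMetric
    (fun x v hv ↦ isRiemannian_closedBallEuclideanMetric x v hv)

/-- Unfolding: the scalar products of `closedBallEuclideanRiemannianMetric` are
`⟪D_x v, D_x w⟫`. [folklore] -/
@[simp] theorem closedBallEuclideanRiemannianMetric_inner {k : ℕ∞ω} (hk : k ≤ ∞) (x : 𝔻 (n + 1))
    (v w : TangentSpace (𝓡∂ (n + 1)) x) :
    (closedBallEuclideanRiemannianMetric n hk).inner x v w =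
      ⟪closedBallCoeDeriv x v, closedBallCoeDeriv x w⟫ :=
  closedBallEuclideanMetric_val x v w

/-- The scalar products of `closedBallEuclideanRiemannianMetric` are those of
`closedBallEuclideanMetric`. [folklore] -/
theorem closedBallEuclideanRiemannianMetric_inner_eq_val {k : ℕ∞ω} (hk : k ≤ ∞) (x : 𝔻 (n + 1))
    (v w : TangentSpace (𝓡∂ (n + 1)) x) :
    (closedBallEuclideanRiemannianMetric n hk).inner x v w = (closedBallEuclideanMetric n).val x v w :=
  rfl

/-- Back to the tree's `PseudoRiemannianMetric`: `ofRiemannian` of the `C^k` bundled metric is the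
`C^k` truncation of `closedBallEuclideanMetric` (same scalar products). [folklore] -/
theorem val_ofRiemannian_closedBallEuclideanRiemannianMetric {k : ℕ∞ω} (hk : k ≤ ∞) (x : 𝔻 (n + 1)) :
    (ofRiemannian (closedBallEuclideanRiemannianMetric n hk)).val x =
      (closedBallEuclideanMetric n).val x :=
  rfl

/-! ### Pullbacks of `ḡ` along maps into the ball are computed ambiently -/

section Pullback

variable {E' : Type*} [NormedAddCommGroup E'] [NormedSpace ℝ E'] {H' : Type*} [TopologicalSpace H']
  {I' : ModelWithCorners ℝ E' H'} {P : Type*} [TopologicalSpace P] [ChartedSpace H' P]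
  {f : P → 𝔻 (n + 1)} {p : P}

/-- **Chain rule through the inclusion**: for a map `f` into the closed ball, differentiable at
`p`, `D_{f p} (df_p v) = d(val ∘ f)_p v` — the differential of `f` read ambiently.
[folklore] -/
theorem closedBallCoeDeriv_mfderiv_apply (hf : MDifferentiableAt I' (𝓡∂ (n + 1)) f p)
    (v : TangentSpace I' p) :
    closedBallCoeDeriv (f p) (mfderiv I' (𝓡∂ (n + 1)) f p v) =
      mfderiv I' 𝓘(ℝ, 𝔼 (n + 1)) (Subtype.val ∘ f) p v := by
  rw [mfderiv_comp p ((contMDiff_coe_closedBall (f p)).mdifferentiableAt (by simp)) hf,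
    mfderiv_coe_closedBall]
  rfl

/-- **`ḡ_{f p}(df_p v, df_p w) = ⟪d(val ∘ f)_p v, d(val ∘ f)_p w⟫`**: the pullback of the
Euclidean metric of the ball along a map `f` into it is the pullback of `⟪·, ·⟫` along the
ambient map `val ∘ f` (functoriality of pullback, O'Neill 1983, Ch. 3, p. 58). [cite: ONeill1983, Ch. 3, p. 58] -/
theorem closedBallEuclideanMetric_val_mfderiv (hf : MDifferentiableAt I' (𝓡∂ (n + 1)) f p)
    (v w : TangentSpace I' p) :
    (closedBallEuclideanMetric n).val (f p) (mfderiv I' (𝓡∂ (n + 1)) f p v)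
        (mfderiv I' (𝓡∂ (n + 1)) f p w) =
      @inner ℝ (𝔼 (n + 1)) _ (mfderiv I' 𝓘(ℝ, 𝔼 (n + 1)) (Subtype.val ∘ f) p v)
        (mfderiv I' 𝓘(ℝ, 𝔼 (n + 1)) (Subtype.val ∘ f) p w) := by
  rw [closedBallEuclideanMetric_val, closedBallCoeDeriv_mfderiv_apply hf,
    closedBallCoeDeriv_mfderiv_apply hf]

/-- The same for the bundled `C^k` metric. [cite: ONeill1983, Ch. 3, p. 58] -/
theorem closedBallEuclideanRiemannianMetric_inner_mfderiv {k : ℕ∞ω} (hk : k ≤ ∞)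
    (hf : MDifferentiableAt I' (𝓡∂ (n + 1)) f p) (v w : TangentSpace I' p) :
    (closedBallEuclideanRiemannianMetric n hk).inner (f p) (mfderiv I' (𝓡∂ (n + 1)) f p v)
        (mfderiv I' (𝓡∂ (n + 1)) f p w) =
      @inner ℝ (𝔼 (n + 1)) _ (mfderiv I' 𝓘(ℝ, 𝔼 (n + 1)) (Subtype.val ∘ f) p v)
        (mfderiv I' 𝓘(ℝ, 𝔼 (n + 1)) (Subtype.val ∘ f) p w) :=
  closedBallEuclideanMetric_val_mfderiv hf v w

end Pullback

end Literature.Geometry.Riemannian
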